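import Mathlib
import Summits.ValiantsHypothesis.ValiantsHypothesis.Theorems.KPlusLogSqLawTropicalBSplitDefs
import Summits.ValiantsHypothesis.ValiantsHypothesis.Theorems.KPlusLogSqLawValuativeDoorProductCount

/-!
# Route «KPlusLogSqLaw», crux `TropicalB` (stmt-ValiantsHypothesis-19771) — the DROP LAW:
# a dominant chain is paid for in EXPONENT DROPS, `n ≤ (K − 1)·(m + #drops)`, counted by columns or by rows

HONEST FRAMING.  Helper file (cell `pub-symmetroid`, seat val-sym-trop-p1 g31, 2026-08-29) `--supports` the crux
`Summit.ValiantsHypothesis.ValiantsHypothesis.Theses.KPlusLogSqLaw.TropicalB` (item `stmt-ValiantsHypothesis-19771`, registered stubs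
`stub_tropThin` / `stub_tropFat` of `Cruxes/TropicalB/Lines/birth.lean`).  Elementary ACCOUNTING valid for every dominance design of every
format, every exponent vector and every chain of unique optima at strictly increasing slopes with distinct consecutive terms, plus one SECTOR
statement (drop-free chains).  Def-free.  Nothing here bounds `TropicalB` for general designs and nothing bears on `WeakLifting`,
DoorA26 / DoorA34, `MatrixDescartes` (stmt-ValiantsHypothesis-18050) or VP ≠ VNP.

VOCABULARY (inline, no definitions).  Along a chain `p₀, …, pₙ` (`pₖ = (σₖ, λₖ)`) the EXPONENT of column `b` at time `k` is `d (λₖ b)`; the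
exponent of ROW `a` at time `k` is that of the column it occupies, `d (λₖ (σₖ⁻¹ a))`.  A column DROP is a pair `(b, k)`, `k < n`, with
`d (λₖ₊₁ b) < d (λₖ b)`; a row DROP is a pair `(a, k)` with `d (λₖ₊₁ (σₖ₊₁⁻¹ a)) < d (λₖ (σₖ⁻¹ a))` (the row moved to — or was re-classed
into — an incidence of smaller exponent).

CONTENT.
* `DropLaw.sum_succ_sub_castSucc` — telescoping over `Fin n`; `DropLaw.card_rises_le` — a sequence `f₀, …, fₙ` of naturals bounded by `R` rises
  (`fₖ < fₖ₊₁`) at most `R·(1 + #falls)` times.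
* `DropLaw.le_mul_add_drops` — **abstract drop law**: if `e : Fin (n+1) → ι → ℕ` takes values in a finite set `S` and the totals `Σ_x e k x`
  strictly increase, then `n ≤ (#S − 1)·(#ι + #{(x,k) : e (k+1) x < e k x})` (every step has a rising coordinate; per coordinate the RANK in `S`
  telescopes: a rise lifts it by `≥ 1`, a drop lowers it by `≤ #S − 1`).
* `DropLaw.chain_le_colDrops` — **COLUMN DROP LAW**: unique optima `p₀, …, pₙ` at strictly increasing slopes with consecutive terms distinct have
  `n ≤ (K − 1)·(m + #column drops)`;  `DropLaw.chain_le_rowDrops` — **ROW DROP LAW**: the same with row drops.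
* `DropLaw.chain_le_of_dropFree` / `DropLaw.chain_le_of_rowDropFree` — **DROP-FREE SECTOR**: if no column (resp. no row) ever lowers its exponent,
  `n ≤ (K − 1)·m`;  `DropLaw.tropicalB_shape_of_dropFree` — hence `n ≤ 2^(1·(K + ⌊log₂ m⌋²))`, the inequality of `TropicalB` with `C = 1`, for every
  sign-alternating dominant chain of that sector (`DropLaw.pred_mul_le_two_pow`).
READING (no claim beyond the theorems).  Slope counting bounds a chain by the number of class histograms; the drop law says WHERE a long chain must
spend: a chain with `n > (K − 1)·m` lowers the exponent of columns, and of rows, more than `n/(K − 1) − m` times each — every mechanism that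
multiplies digits is a mechanism of repeated exponent DROPS (the cell's «resets», «returns», «escorts»), each of which the pairwise exchange law
(`sum_d_lt_of_isDominant_invariant`, …TropicalCycleMonotone) obliges to be repaid inside its own exchange orbit against every earlier term.  The
monotone term families of …TropicalBIsotoneRegisters are the structured special case `#drops = 0`.  [this seat; folklore telescoping]
-/

set_option linter.dupNamespace false
set_option autoImplicit false

namespace Summit.ValiantsHypothesis.ValiantsHypothesis.Theorems.KPlusLogSqLaw

open Summit.ValiantsHypothesis.ValiantsHypothesis.Theorems.MatrixDescartes.Negative
open Summit.ValiantsHypothesis.ValiantsHypothesis.Theorems.LacunarySymmetroidMatrixDescartes.TropicalCensus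
open Finset

namespace DropLaw

/-! ## 1. Telescoping over `Fin n` -/

/-- `Σ_{k<n} (g (k+1) − g k) = g n − g 0` on `Fin (n+1)`. [folklore] -/
theorem sum_succ_sub_castSucc : ∀ (n : ℕ) (g : Fin (n + 1) → ℤ),
    ∑ k : Fin n, (g k.succ - g k.castSucc) = g (Fin.last n) - g 0
  | 0, g => by simp
  | n + 1, g => by
      rw [Fin.sum_univ_castSucc]
      have ih := sum_succ_sub_castSucc n (fun k => g k.castSucc)
      simp only [← Fin.succ_castSucc] at ih ⊢
      rw [ih, Fin.succ_last]
      simp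

/-- **a sequence of naturals bounded by `R` rises at most `R·(1 + #falls)` times.** [folklore] -/
theorem card_rises_le {n : ℕ} (f : Fin (n + 1) → ℕ) (R : ℕ) (hf : ∀ k, f k ≤ R) :
    (univ.filter fun k : Fin n => f k.castSucc < f k.succ).card ≤
      R * (1 + (univ.filter fun k : Fin n => f k.succ < f k.castSucc).card) := by
  have htel := sum_succ_sub_castSucc n (fun k => (f k : ℤ))
  -- pointwise: the increment is ≥ [rise] − R·[fall]
  have hpt : ∀ k ∈ (univ : Finset (Fin n)),
      (if f k.castSucc < f k.succ then (1 : ℤ) else 0) - (R : ℤ) * (if f k.succ < f k.castSucc then 1 else 0)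
        ≤ (f k.succ : ℤ) - f k.castSucc := by
    intro k _
    have h1 := hf k.succ
    have h0 := hf k.castSucc
    by_cases hr : f k.castSucc < f k.succ
    · have : ¬ f k.succ < f k.castSucc := by omega
      rw [if_pos hr, if_neg this]; omega
    · rw [if_neg hr]
      by_cases hd : f k.succ < f k.castSucc
      · rw [if_pos hd]
        have : (f k.castSucc : ℤ) ≤ R := by exact_mod_cast h0
        have : (0 : ℤ) ≤ f k.succ := by positivity
        linarith
      · rw [if_neg hd]; omega
  have hsum := Finset.sum_le_sum hpt
  rw [htel, sum_sub_distrib, ← mul_sum, Finset.sum_boole, Finset.sum_boole] at hsum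
  have hn : (f (Fin.last n) : ℤ) ≤ R := by exact_mod_cast hf _
  have h0 : (0 : ℤ) ≤ f 0 := by positivity
  have : ((univ.filter fun k : Fin n => f k.castSucc < f k.succ).card : ℤ) ≤
      R * (1 + ((univ.filter fun k : Fin n => f k.succ < f k.castSucc).card : ℤ)) := by
    linarith
  exact_mod_cast this

/-! ## 2. Ranks in a finite set of naturals: `#(S.filter (· < x))` — the tree's `ValDoor.card_filter_lt_lt/_mono/_le`
(…ValuativeDoorProductCount) are reused. -/

/-! ## 3. The abstract drop law -/

/-- **abstract drop law.**  Values in `S`, totals strictly increasing ⇒ `n ≤ (#S − 1)·(#ι + #drops)`. [this seat] -/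
theorem le_mul_add_drops {ι : Type*} [Fintype ι] {n : ℕ} (S : Finset ℕ) (e : Fin (n + 1) → ι → ℕ)
    (hS : ∀ k x, e k x ∈ S) (hinc : ∀ k : Fin n, ∑ x, e k.castSucc x < ∑ x, e k.succ x) :
    n ≤ (S.card - 1) * (Fintype.card ι +
      ((univ ×ˢ univ).filter fun xk : ι × Fin n => e xk.2.succ xk.1 < e xk.2.castSucc xk.1).card) := by
  classical
  set R := S.card - 1 with hR
  set rise : ι → Finset (Fin n) := fun x => univ.filter fun k => e k.castSucc x < e k.succ x with hrise
  set drop : ι → Finset (Fin n) := fun x => univ.filter fun k => e k.succ x < e k.castSucc x with hdrop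
  -- (a) every step has a rising coordinate, so n ≤ Σ_x #rise x
  have ha : n ≤ ∑ x, (rise x).card := by
    have h1 : ∀ k ∈ (univ : Finset (Fin n)), 1 ≤ ∑ x, (if e k.castSucc x < e k.succ x then 1 else 0 : ℕ) := by
      intro k _
      obtain ⟨x, _, hx⟩ := Finset.exists_lt_of_sum_lt (hinc k)
      calc 1 = (if e k.castSucc x < e k.succ x then 1 else 0 : ℕ) := by rw [if_pos hx]
        _ ≤ ∑ x, (if e k.castSucc x < e k.succ x then 1 else 0 : ℕ) :=
            Finset.single_le_sum (f := fun x => (if e k.castSucc x < e k.succ x then 1 else 0 : ℕ))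
              (by intro i _; positivity) (mem_univ x)
    calc n = ∑ _k : Fin n, 1 := by simp
      _ ≤ ∑ k : Fin n, ∑ x, (if e k.castSucc x < e k.succ x then 1 else 0 : ℕ) := Finset.sum_le_sum h1
      _ = ∑ x, ∑ k : Fin n, (if e k.castSucc x < e k.succ x then 1 else 0 : ℕ) := Finset.sum_comm
      _ = ∑ x, (rise x).card := by
          refine Finset.sum_congr rfl fun x _ => ?_
          rw [hrise, Finset.card_filter]
  -- (b) per coordinate, ranks telescope: #rise x ≤ R·(1 + #drop x)
  have hb : ∀ x, (rise x).card ≤ R * (1 + (drop x).card) := by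
    intro x
    have key := card_rises_le (fun k => (S.filter fun z => z < e k x).card) R (fun k => ValDoor.card_filter_lt_le (hS k x))
    have er : rise x = univ.filter fun k : Fin n =>
        (S.filter fun z => z < e k.castSucc x).card < (S.filter fun z => z < e k.succ x).card := by
      rw [hrise]
      refine Finset.filter_congr fun k _ => ⟨fun h => ValDoor.card_filter_lt_lt (hS _ x) h, fun h => ?_⟩
      by_contra hc
      exact absurd (ValDoor.card_filter_lt_mono S (not_lt.mp hc)) (not_le.mpr h)
    have ed : drop x = univ.filter fun k : Fin n =>
        (S.filter fun z => z < e k.succ x).card < (S.filter fun z => z < e k.castSucc x).card := by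
      rw [hdrop]
      refine Finset.filter_congr fun k _ => ⟨fun h => ValDoor.card_filter_lt_lt (hS _ x) h, fun h => ?_⟩
      by_contra hc
      exact absurd (ValDoor.card_filter_lt_mono S (not_lt.mp hc)) (not_le.mpr h)
    rw [er, ed]; exact key
  -- (c) assemble
  have hc : ∑ x, (drop x).card =
      ((univ ×ˢ univ).filter fun xk : ι × Fin n => e xk.2.succ xk.1 < e xk.2.castSucc xk.1).card := by
    rw [Finset.card_filter, Finset.sum_product]
    refine Finset.sum_congr rfl fun x _ => ?_
    rw [hdrop, Finset.card_filter]
  calc n ≤ ∑ x, (rise x).card := ha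
    _ ≤ ∑ x, R * (1 + (drop x).card) := Finset.sum_le_sum fun x _ => hb x
    _ = R * (Fintype.card ι + ∑ x, (drop x).card) := by
        rw [← mul_sum, sum_add_distrib, sum_const, smul_eq_mul, mul_one, Finset.card_univ]
    _ = _ := by rw [hc]

/-! ## 4. The drop laws for dominant chains -/

variable {m K : ℕ} (d : Fin K → ℕ) (v ε : Fin m → Fin m → Fin K → ℤ) {n : ℕ} {θ : Fin (n + 1) → ℤ}
  {p : Fin (n + 1) → Equiv.Perm (Fin m) × (Fin m → Fin K)}

/-- the slopes of consecutive distinct dominant terms strictly increase, in `ℕ`. [folklore: `slope_lt_of_dominant`] -/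
theorem sum_d_lt_succ (hθ : StrictMono θ) (hdom : ∀ k, IsDominant d v ε (θ k) (p k))
    (hne : ∀ k : Fin n, p k.castSucc ≠ p k.succ) (k : Fin n) :
    ∑ b, d ((p k.castSucc).2 b) < ∑ b, d ((p k.succ).2 b) := by
  have hs := slope_lt_of_dominant d v ε (hθ (Fin.castSucc_lt_succ (i := k))) (hne k) (hdom _) (hdom _)
  unfold LacunarySymmetroidMatrixDescartes.TropicalCensus.slope at hs
  have : ((∑ b, d ((p k.castSucc).2 b) : ℕ) : ℤ) < ((∑ b, d ((p k.succ).2 b) : ℕ) : ℤ) := by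
    push_cast; exact hs
  exact_mod_cast this

/-- at most `K` exponent values. [folklore] -/
theorem card_image_d_sub_one_le : (univ.image d).card - 1 ≤ K - 1 := by
  have := Finset.card_image_le (s := (univ : Finset (Fin K))) (f := d)
  rw [Finset.card_univ, Fintype.card_fin] at this
  omega

/-- **COLUMN DROP LAW**: `n ≤ (K − 1)·(m + #{(b,k) : d (λₖ₊₁ b) < d (λₖ b)})`. [this seat] -/
theorem chain_le_colDrops (hθ : StrictMono θ) (hdom : ∀ k, IsDominant d v ε (θ k) (p k))
    (hne : ∀ k : Fin n, p k.castSucc ≠ p k.succ) :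
    n ≤ (K - 1) * (m + ((univ ×ˢ univ).filter fun bk : Fin m × Fin n =>
      d ((p bk.2.succ).2 bk.1) < d ((p bk.2.castSucc).2 bk.1)).card) := by
  classical
  have h := le_mul_add_drops (univ.image d) (fun k b => d ((p k).2 b))
    (fun k b => mem_image_of_mem d (mem_univ _)) (sum_d_lt_succ d v ε hθ hdom hne)
  rw [Fintype.card_fin] at h
  exact h.trans (Nat.mul_le_mul_right _ (card_image_d_sub_one_le d))

/-- **ROW DROP LAW**: `n ≤ (K − 1)·(m + #{(a,k) : d (λₖ₊₁ (σₖ₊₁⁻¹ a)) < d (λₖ (σₖ⁻¹ a))})`. [this seat] -/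
theorem chain_le_rowDrops (hθ : StrictMono θ) (hdom : ∀ k, IsDominant d v ε (θ k) (p k))
    (hne : ∀ k : Fin n, p k.castSucc ≠ p k.succ) :
    n ≤ (K - 1) * (m + ((univ ×ˢ univ).filter fun ak : Fin m × Fin n =>
      d ((p ak.2.succ).2 ((p ak.2.succ).1.symm ak.1)) < d ((p ak.2.castSucc).2 ((p ak.2.castSucc).1.symm ak.1))).card) := by
  classical
  have hrow : ∀ k, ∑ a, d ((p k).2 ((p k).1.symm a)) = ∑ b, d ((p k).2 b) := fun k =>
    Equiv.sum_comp (p k).1.symm (fun b => d ((p k).2 b))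
  have h := le_mul_add_drops (univ.image d) (fun k a => d ((p k).2 ((p k).1.symm a)))
    (fun k a => mem_image_of_mem d (mem_univ _)) (by
      intro k
      show ∑ a, d ((p k.castSucc).2 ((p k.castSucc).1.symm a)) < ∑ a, d ((p k.succ).2 ((p k.succ).1.symm a))
      rw [hrow, hrow]; exact sum_d_lt_succ d v ε hθ hdom hne k)
  rw [Fintype.card_fin] at h
  exact h.trans (Nat.mul_le_mul_right _ (card_image_d_sub_one_le d))

/-- **DROP-FREE SECTOR (columns)**: if no column ever lowers its exponent along the chain, `n ≤ (K − 1)·m`. [this seat] -/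
theorem chain_le_of_dropFree (hθ : StrictMono θ) (hdom : ∀ k, IsDominant d v ε (θ k) (p k))
    (hne : ∀ k : Fin n, p k.castSucc ≠ p k.succ)
    (hfree : ∀ (k : Fin n) (b : Fin m), d ((p k.castSucc).2 b) ≤ d ((p k.succ).2 b)) :
    n ≤ (K - 1) * m := by
  classical
  have h := chain_le_colDrops d v ε hθ hdom hne
  have h0 : ((univ ×ˢ univ).filter fun bk : Fin m × Fin n =>
      d ((p bk.2.succ).2 bk.1) < d ((p bk.2.castSucc).2 bk.1)).card = 0 := by
    rw [Finset.card_eq_zero, Finset.filter_eq_empty_iff]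
    intro bk _
    exact not_lt.mpr (hfree bk.2 bk.1)
  rw [h0, add_zero] at h
  exact h

/-- **DROP-FREE SECTOR (rows)**: if no row ever lowers its exponent along the chain, `n ≤ (K − 1)·m`. [this seat] -/
theorem chain_le_of_rowDropFree (hθ : StrictMono θ) (hdom : ∀ k, IsDominant d v ε (θ k) (p k))
    (hne : ∀ k : Fin n, p k.castSucc ≠ p k.succ)
    (hfree : ∀ (k : Fin n) (a : Fin m),
      d ((p k.castSucc).2 ((p k.castSucc).1.symm a)) ≤ d ((p k.succ).2 ((p k.succ).1.symm a))) :
    n ≤ (K - 1) * m := by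
  classical
  have h := chain_le_rowDrops d v ε hθ hdom hne
  have h0 : ((univ ×ˢ univ).filter fun ak : Fin m × Fin n =>
      d ((p ak.2.succ).2 ((p ak.2.succ).1.symm ak.1)) < d ((p ak.2.castSucc).2 ((p ak.2.castSucc).1.symm ak.1))).card = 0 := by
    rw [Finset.card_eq_zero, Finset.filter_eq_empty_iff]
    intro ak _
    exact not_lt.mpr (hfree ak.2 ak.1)
  rw [h0, add_zero] at h
  exact h

/-- arithmetic: `(K − 1)·m ≤ 2^(K + ⌊log₂ m⌋²)`. [arithmetic] -/
theorem pred_mul_le_two_pow (m K : ℕ) : (K - 1) * m ≤ 2 ^ (K + Nat.log 2 m ^ 2) := by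
  have hK : K - 1 ≤ 2 ^ K := (Nat.sub_le K 1).trans Nat.lt_two_pow_self.le
  rcases Nat.eq_zero_or_pos m with rfl | hm
  · simp
  set L := Nat.log 2 m with hL
  have hm2 : m < 2 ^ (L + 1) := hL ▸ Nat.lt_pow_succ_log_self (by norm_num) m
  rcases Nat.lt_or_ge L 2 with hL2 | hL2
  · -- `m ≤ 3`: `(K-1)·m ≤ 3(K-1) ≤ 2·2^K ≤ 2^(K+1)`… we use `3(K−1) ≤ 2^(K+1)` and `K + 1 ≤ K + L²` unless `L = 0`
    have h4 : 2 ^ (L + 1) ≤ 2 ^ 2 := Nat.pow_le_pow_right (by norm_num) (by omega)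
    have hm3 : m ≤ 3 := by omega
    -- `3·(K−1) ≤ 2^K` for all `K`
    have h3 : 3 * (K - 1) ≤ 2 ^ K := by
      rcases K with _ | _ | _ | K
      · simp
      · simp
      · norm_num
      · have h := @Nat.lt_two_pow_self (K + 1)
        calc 3 * (K + 3 - 1) = 3 * (K + 2) := by omega
          _ ≤ 4 * 2 ^ (K + 1) := by omega
          _ = 2 ^ (K + 3) := by ring
    calc (K - 1) * m ≤ (K - 1) * 3 := Nat.mul_le_mul_left _ hm3
      _ ≤ 2 ^ K := by omega
      _ ≤ 2 ^ (K + L ^ 2) := Nat.pow_le_pow_right (by norm_num) (by omega)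
  · have hLL : L + 1 ≤ L ^ 2 := by nlinarith
    calc (K - 1) * m ≤ 2 ^ K * 2 ^ (L + 1) := Nat.mul_le_mul hK hm2.le
      _ = 2 ^ (K + (L + 1)) := by rw [← pow_add]
      _ ≤ 2 ^ (K + L ^ 2) := Nat.pow_le_pow_right (by norm_num) (by omega)

/-- **`TropicalB`-shape of the drop-free sector** (`C = 1`): a sign-alternating dominant chain in which no column ever lowers its
exponent has `n ≤ 2^(1·(K + ⌊log₂ m⌋²))` (the hypothesis list of `TropRootLawAt m K ·` plus drop-freeness). [this seat] -/
theorem tropicalB_shape_of_dropFree (hθ : StrictMono θ) (hdom : ∀ k, IsDominant d v ε (θ k) (p k))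
    (halt : ∀ k : Fin n, termSign ε (p k.castSucc) * termSign ε (p k.succ) < 0)
    (hfree : ∀ (k : Fin n) (b : Fin m), d ((p k.castSucc).2 b) ≤ d ((p k.succ).2 b)) :
    n ≤ 2 ^ (1 * (K + Nat.log 2 m ^ 2)) := by
  rw [one_mul]
  exact (chain_le_of_dropFree d v ε hθ hdom (ne_succ_of_alternating ε p halt) hfree).trans (pred_mul_le_two_pow m K)

end DropLaw

end Summit.ValiantsHypothesis.ValiantsHypothesis.Theorems.KPlusLogSqLaw
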